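import Summits.CriticalPhenomena.PercolationContinuityZ3.Theorems.Transplant.CoarseRegionTransfer
import HarnessLib

/-!
# The DST transfer for a SCALE-DEPENDENT coarse region (the variant needed by sub-linear domains of the slab)

builds on p205010 (kernel theorem, internal audit signed; external expert review pending) — NOT used in this file.
Lane `prim-bschramm`, seat `prim-bschramm-p2` (gen 24; class C1b, METHOD = input substitution; memo `HOME/bschramm/P2-LATTICES.md` §86, plan (N1));
helper file (`--supports stmt-CriticalPhenomena-4575 --as helper`).

`CoarseRegionTransfer.exists_percolatesVia_pos_of_theta_slab_pos` takes ONE coarse region `C` for all block sizes `n` — enough for cones (scale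
invariant).  For a sub-linear planar domain (a staircase `{0 ≤ x₂ ≤ g(x₁)}`, `g/log → ∞`) the coarse picture of the domain at block size `n` is the
region under `g(4n·)/4n`, which depends on `n`; the proof of the transfer uses `C` only after `n` is fixed, so the same argument gives
**`exists_percolatesVia_pos_of_theta_slab_pos_varying`**: coarse regions `C n`, fine regions `T n`, (BOX) for each `n`, (DEP) with one `η` for all `n`.
[cite: DuminilCopinSidoraviciusTassion2016, §2.1 eq. (13), §2.2 (p. 6)] [cite: GrimmettPercolation1999, §11.5 Thm. (11.55)]
-/

noncomputable section

namespace Summit.CriticalPhenomena.PercolationContinuityZ3.Theorems.Transplant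

namespace CoarseTransferN

open MeasureTheory Literature.Probability.Percolation Literature.Probability.LatticeModels SimpleGraph
open scoped ENNReal

variable (k : ℕ)

/-- **Supercritical slabs percolate inside every fine region holding the boxes of a SCALE-DEPENDENT coarse region with dependent percolation** (`k > 0`; the
coarse region `C n` may depend on the block size `n`, with (DEP) uniform in `n`):
if (DEP) every `5`-dependent bond percolation on `ℤ²` of edge density `≥ 1 - η` percolates inside `C` from `0` with positive probability,
(BOX) ties `C` to the fine regions `T n`, and `θ_{S_k}(0, p) > 0`, then for some block size `n ≥ 1` and some vertex `a` of
`\overline{B_n}`, `P_p(a ↔ ∞ inside \overline{T n}) > 0`.  DST's finite-size criterion at `p` (`DuminilCopinSidoraviciusTassion2016_goodEvent_likely_holds`),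
the good-edge law as a `5`-dependent bond percolation on `ℤ²` (`disjoint_coarseRegion`, `real_goodEvent_shift`), (DEP) and §1.
[cite: DuminilCopinSidoraviciusTassion2016, §2.1 eq. (13) and §2.2 (p. 6)] -/
theorem exists_percolatesVia_pos_of_theta_slab_pos_varying {C : ℕ → Set (Site 2)} {T : ℕ → Set (ℤ × ℤ)}
    (hT : ∀ n : ℕ, ∀ x ∈ C n, ∀ i : Fin 2, sqBox (coarsePt n x + coarseShift (2 * n) i) (6 * n) ⊆ T n)
    (hdep : ∃ η : ℝ, 0 < η ∧ ∀ (n : ℕ) (μ : Measure (BondConfig (Site 2))) [IsProbabilityMeasure μ],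
      (∀ (F₁ F₂ : Finset (Sym2 (Site 2))),
          (∀ e₁ ∈ F₁, ∀ e₂ ∈ F₂, ∀ a ∈ e₁, ∀ b ∈ e₂, ((5 : ℕ) : ℤ) ≤ max |a 0 - b 0| |a 1 - b 1|) →
          ∀ (A B : Set (BondConfig (Site 2))), DeterminedBy A (↑F₁ : Set (Sym2 (Site 2))) →
            DeterminedBy B (↑F₂ : Set (Sym2 (Site 2))) → MeasurableSet A → MeasurableSet B →
            μ (A ∩ B) = μ A * μ B) →
      (∀ e ∈ (zdGraph 2).edgeSet, 1 - η ≤ μ.real {ω | e ∈ ω}) →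
      0 < μ.real (percolatesVia (withinGraph (zdGraph 2) (C n)) 0))
    (hk : 0 < k) (p : unitInterval) (hθ : 0 < theta (slabGraph 3 k) (slabOrigin 3 k) p) :
    ∃ n : ℕ, 1 ≤ n ∧ ∃ a ∈ slabLift k (sqBox 0 n),
      0 < (bondPercolation (slabGraph 3 k) p).real (percolatesVia (withinGraph (slabGraph 3 k) (slabLift k (T n))) a) := by
  obtain ⟨η₀, hη₀pos, hD5⟩ := hdep
  obtain ⟨n, u, hn, hu, hgood⟩ := DuminilCopinSidoraviciusTassion2016_goodEvent_likely_holds k hk p hθ η₀ hη₀pos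
  set P := bondPercolation (slabGraph 3 k) p with hP
  set Kq := withinGraph (zdGraph 2) (C n) with hKq
  -- the good-edge configuration as a dependent bond percolation on `ℤ²`
  set μ := P.map (coarseConfig k n u) with hμ
  haveI : IsProbabilityMeasure μ :=
    Measure.isProbabilityMeasure_map (measurable_coarseConfig k n u).aemeasurable
  have hdep : ∀ (F₁ F₂ : Finset (Sym2 (Site 2))),
      (∀ e₁ ∈ F₁, ∀ e₂ ∈ F₂, ∀ a ∈ e₁, ∀ b ∈ e₂, ((5 : ℕ) : ℤ) ≤ max |a 0 - b 0| |a 1 - b 1|) →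
      ∀ (A B : Set (BondConfig (Site 2))), DeterminedBy A (↑F₁ : Set (Sym2 (Site 2))) →
        DeterminedBy B (↑F₂ : Set (Sym2 (Site 2))) → MeasurableSet A → MeasurableSet B →
        μ (A ∩ B) = μ A * μ B := by
    intro F₁ F₂ hfar A B hA hB hAm hBm
    rw [hμ, Measure.map_apply (measurable_coarseConfig k n u) (hAm.inter hBm),
      Measure.map_apply (measurable_coarseConfig k n u) hAm,
      Measure.map_apply (measurable_coarseConfig k n u) hBm, Set.preimage_inter]
    exact bondPercolation_inter_of_disjoint (slabGraph 3 k) p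
      (disjoint_coarseRegion k hn (by exact_mod_cast hfar))
      (determinedBy_preimage_coarseConfig k n u hA) (determinedBy_preimage_coarseConfig k n u hB)
      (hAm.preimage (measurable_coarseConfig k n u)) (hBm.preimage (measurable_coarseConfig k n u))
  have hmarg : ∀ e ∈ (zdGraph 2).edgeSet, 1 - η₀ ≤ μ.real {ω | e ∈ ω} := by
    intro e he
    have key : ∀ (x : Site 2) (i : Fin 2),
        1 - η₀ ≤ μ.real {ω : BondConfig (Site 2) | s(x, x + Pi.single i 1) ∈ ω} := by
      intro x i
      rw [hμ, map_measureReal_apply (measurable_coarseConfig k n u) (measurableSet_mem _)]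
      have hpre : coarseConfig k n u ⁻¹' {ω : BondConfig (Site 2) | s(x, x + Pi.single i 1) ∈ ω} =
          goodEvent k n u (coarsePt n x) i := by
        ext ω; exact mk_mem_coarseConfig_iff k n u ω x i
      rw [hpre, hP, real_goodEvent_shift]
      have h1 := hgood i
      linarith
    induction e using Sym2.ind with
    | h a b =>
      rw [SimpleGraph.mem_edgeSet] at he
      obtain ⟨i, hab | hab⟩ := (zdGraph_adj_iff a b).1 he
      · rw [hab]; exact key a i
      · rw [hab, Sym2.eq_swap]; exact key b i
  -- percolation of the good edges inside the coarse region, transferred to the slab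
  have hperc := hD5 n μ hdep hmarg
  rw [hμ, map_measureReal_apply (measurable_coarseConfig k n u) (measurableSet_percolatesVia Kq 0)] at hperc
  have hle : P.real (coarseConfig k n u ⁻¹' percolatesVia Kq 0) ≤
      P.real (⋃ a ∈ slabLift k (sqBox 0 u), percolatesVia (withinGraph (slabGraph 3 k) (slabLift k (T n))) a) := by
    refine ENNReal.toReal_mono (measure_ne_top _ _) (measure_mono_ae ?_)
    filter_upwards [ProbabilityTheory.setBernoulli_ae_subset (u := (slabGraph 3 k).edgeSet) (p := p)] with ω hω hmem
    obtain ⟨a, ha, hinf⟩ := CoarseTransfer.exists_percolatesVia_of_coarse k (hT n) hω hn hu hmem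
    exact Set.mem_biUnion ha hinf
  obtain ⟨a, ha, hθa⟩ : ∃ a ∈ slabLift k (sqBox 0 u),
      0 < P.real (percolatesVia (withinGraph (slabGraph 3 k) (slabLift k (T n))) a) := by
    by_contra hcon
    push Not at hcon
    have hnull : P (⋃ a ∈ slabLift k (sqBox 0 u), percolatesVia (withinGraph (slabGraph 3 k) (slabLift k (T n))) a) = 0 := by
      refine (measure_biUnion_null_iff (slabLift_finite k (sqBox_finite 0 u)).countable).2 fun a ha => ?_
      have := hcon a ha
      have h0 : P.real (percolatesVia (withinGraph (slabGraph 3 k) (slabLift k (T n))) a) = 0 :=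
        le_antisymm this measureReal_nonneg
      exact (measureReal_eq_zero_iff (measure_ne_top _ _)).1 h0
    have : P.real (⋃ a ∈ slabLift k (sqBox 0 u), percolatesVia (withinGraph (slabGraph 3 k) (slabLift k (T n))) a) = 0 := by
      rw [measureReal_def, hnull]; simp
    linarith
  exact ⟨n, hn, a, slabLift_mono k (sqBox_mono 0 hu) ha, hθa⟩

end CoarseTransferN

end Summit.CriticalPhenomena.PercolationContinuityZ3.Theorems.Transplant

end
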